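import Mathlib

/-!
# The six-vertex witness `K6` of the vdBHK (2006) mixed-graph conjecture in GENERAL weights, in
the paper's own convention: closed form and exact sign rule (blind cell PercRepro2, lead)

`BHKMixedCore.lean` (this cell) refutes, at every weight `7/8`, the conjecture of van den
Berg–Häggström–Kahn (Random Structures & Algorithms 29 (2006), p. 18) that their Theorem 3.4 survives
undirected edges, on the six-vertex system `K6`: vertices `s = 0`, `t = 1`, `x = 2`, `y = 3`,
`s' = 4`, `t' = 5`; arcs `s → x`, `x → s`, `t → y`, `y → t`, one undirected edge `{x, y}`, and the
pendant arcs `s → s'`, `t → t'`.  `BHKMixedCoreGeneral.lean` proves the mechanism symbolically in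
the root-inclusive convention.  This file does the same in the PAPER'S convention — `C_v` the open
edges on open oriented paths from `v`, `V(C_v)` their endpoints, `Q = {V(C_s) ∩ V(C_t) = ∅}`,
`f = 1[x ∈ V(C_s)]`, `g = 1[y ∉ V(C_t)]` — with the seven edges open independently with
probabilities `A, A', B, B', E, Ps, Pt`:

  `M_Q · M_fg − M_f · M_g = A(1−A) · B(1−B) · E · [(1−A'·Ps)(1−B'·Pt) − (1−E)·A'·Ps·B'·Pt]`,

so the conditional covariance is NEGATIVE exactly when `(1−E)·A'Ps·B'Pt > (1−A'Ps)(1−B'Pt)`: the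
pendant arcs enter only through the products `A'·Ps`, `B'·Pt` (a return to the root counts only if
the root is a vertex of its own cluster), and the all-`7/8` witness is the point
`2401/32768 > 225/4096`.  The reachability is computed on the `2^7` configurations by `decide`
inside `simp`; the identity is then a polynomial identity closed by `ring`.
-/

namespace Summit.Ventures.PercRepro2.BHKMixedK6General

/-- An edge of a mixed graph: `arc = true` is the arc `u → v`, `arc = false` the undirected edge
`{u, v}`. -/
structure MEdge where
  arc : Bool
  u : Nat
  v : Nat

/-- The seven edges of `K6`: `0 = s → x`, `1 = x → s`, `2 = t → y`, `3 = y → t`, `4 = {x, y}`,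
`5 = s → s'`, `6 = t → t'`. -/
def edge : Nat → MEdge
  | 0 => ⟨true,  0, 2⟩
  | 1 => ⟨true,  2, 0⟩
  | 2 => ⟨true,  1, 3⟩
  | 3 => ⟨true,  3, 1⟩
  | 4 => ⟨false, 2, 3⟩
  | 5 => ⟨true,  0, 4⟩
  | _ => ⟨true,  1, 5⟩

/-- Edge `i` is open in the configuration `c ∈ [0, 128)` iff bit `i` of `c` is set. -/
def isOpen (c i : Nat) : Bool := c.testBit i

/-- Vertex sets are bitmasks over `0..5`. -/
def mem (S x : Nat) : Bool := S.testBit x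

/-- One expansion step along the open edges (arcs forward, the undirected edge both ways). -/
def step (c S : Nat) : Nat :=
  (List.range 7).foldl (fun S i =>
    let e := edge i
    if isOpen c i then
      let S₁ := if mem S e.u then S ||| (1 <<< e.v) else S
      if e.arc then S₁ else (if mem S₁ e.v then S₁ ||| (1 <<< e.u) else S₁)
    else S) S

/-- `n`-fold iteration of `step c`. -/
def iter (c : Nat) : Nat → Nat → Nat
  | 0, S => S
  | n + 1, S => iter c n (step c S)

/-- `R(v)`: the vertices reachable from `v` by open oriented paths (`v` included). -/
def reach (c v : Nat) : Nat := iter c 6 (1 <<< v)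

/-- `V(C_v)` in the paper's sense: the endpoints of the open edges usable from a vertex of `R(v)`. -/
def VC (c v : Nat) : Nat :=
  let R := reach c v
  (List.range 7).foldl (fun S i =>
    let e := edge i
    if isOpen c i && (mem R e.u || (!e.arc && mem R e.v)) then S ||| (1 <<< e.u) ||| (1 <<< e.v)
    else S) 0

/-- `Q = {V(C_s) ∩ V(C_t) = ∅}`. -/
def Q (c : Nat) : Bool := (VC c 0 &&& VC c 1) == 0
/-- `f = 1[x ∈ V(C_s)]`. -/
def f (c : Nat) : Bool := mem (VC c 0) 2
/-- `g = 1[y ∉ V(C_t)]`. -/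
def g (c : Nat) : Bool := !(mem (VC c 1) 3)

/-- Product Bernoulli weight of the configuration `c` with the seven weights
`A, A', B, B', E, Ps, Pt` in the order of `edge`. -/
def wt (A A' B B' E Ps Pt : ℚ) (c : Nat) : ℚ :=
  (if isOpen c 0 then A else 1 - A) * (if isOpen c 1 then A' else 1 - A') *
    (if isOpen c 2 then B else 1 - B) * (if isOpen c 3 then B' else 1 - B') *
    (if isOpen c 4 then E else 1 - E) * (if isOpen c 5 then Ps else 1 - Ps) *
    (if isOpen c 6 then Pt else 1 - Pt)

/-- `P(Q)`. -/
def massQ (A A' B B' E Ps Pt : ℚ) : ℚ :=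
  ∑ c ∈ Finset.range 128, if Q c then wt A A' B B' E Ps Pt c else 0
/-- `E[f; Q]`. -/
def massfQ (A A' B B' E Ps Pt : ℚ) : ℚ :=
  ∑ c ∈ Finset.range 128, if Q c && f c then wt A A' B B' E Ps Pt c else 0
/-- `E[g; Q]`. -/
def massgQ (A A' B B' E Ps Pt : ℚ) : ℚ :=
  ∑ c ∈ Finset.range 128, if Q c && g c then wt A A' B B' E Ps Pt c else 0
/-- `E[fg; Q]`. -/
def massfgQ (A A' B B' E Ps Pt : ℚ) : ℚ :=
  ∑ c ∈ Finset.range 128, if Q c && f c && g c then wt A A' B B' E Ps Pt c else 0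

set_option maxRecDepth 65536

/-- `P(Q) = 1 − E + E·[(1−A)(1−A'·Ps·B) + A(1−B)(1−B'·Pt)]`. -/
theorem massQ_eq (A A' B B' E Ps Pt : ℚ) :
    massQ A A' B B' E Ps Pt =
      1 - E + E * ((1 - A) * (1 - A' * Ps * B) + A * (1 - B) * (1 - B' * Pt)) := by
  simp (config := {decide := true}) [massQ, Finset.sum_range_succ, wt, isOpen, Q]
  ring

/-- `E[f; Q] = A·(1 − E + E(1−B)(1−B'·Pt))`. -/
theorem massfQ_eq (A A' B B' E Ps Pt : ℚ) :
    massfQ A A' B B' E Ps Pt = A * (1 - E + E * ((1 - B) * (1 - B' * Pt))) := by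
  simp (config := {decide := true}) [massfQ, Finset.sum_range_succ, wt, isOpen, Q, f]
  ring

/-- `E[g; Q] = (1−B)·(1 − E·A·B'·Pt)`. -/
theorem massgQ_eq (A A' B B' E Ps Pt : ℚ) :
    massgQ A A' B B' E Ps Pt = (1 - B) * (1 - E * A * (B' * Pt)) := by
  simp (config := {decide := true}) [massgQ, Finset.sum_range_succ, wt, isOpen, Q, g]
  ring

/-- `E[fg; Q] = A(1−B)·(1 − E·B'·Pt)`. -/
theorem massfgQ_eq (A A' B B' E Ps Pt : ℚ) :
    massfgQ A A' B B' E Ps Pt = A * (1 - B) * (1 - E * (B' * Pt)) := by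
  simp (config := {decide := true}) [massfgQ, Finset.sum_range_succ, wt, isOpen, Q, f, g]
  ring

/-- THE CLOSED FORM in the paper's convention:
`M_Q · M_fg − M_f · M_g = A(1−A)·B(1−B)·E·[(1−A'Ps)(1−B'Pt) − (1−E)·A'Ps·B'Pt]`. -/
theorem covariance_numerator (A A' B B' E Ps Pt : ℚ) :
    massQ A A' B B' E Ps Pt * massfgQ A A' B B' E Ps Pt
        - massfQ A A' B B' E Ps Pt * massgQ A A' B B' E Ps Pt =
      A * (1 - A) * (B * (1 - B)) * E *
        ((1 - A' * Ps) * (1 - B' * Pt) - (1 - E) * (A' * Ps * (B' * Pt))) := by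
  rw [massQ_eq, massfQ_eq, massgQ_eq, massfgQ_eq]; ring

/-- The sign rule in the paper's convention: for `A, B, E ∈ (0, 1)` and `A'Ps, B'Pt ≤ 1` the
conditional covariance is negative iff `(1−E)·A'Ps·B'Pt > (1−A'Ps)(1−B'Pt)`. -/
theorem covariance_neg_iff (A A' B B' E Ps Pt : ℚ) (hA : 0 < A) (hA1 : A < 1) (hB : 0 < B)
    (hB1 : B < 1) (hE : 0 < E) (hE1 : E < 1) (hA' : A' * Ps ≤ 1) (hB' : B' * Pt ≤ 1) :
    massfgQ A A' B B' E Ps Pt / massQ A A' B B' E Ps Pt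
        < (massfQ A A' B B' E Ps Pt / massQ A A' B B' E Ps Pt)
            * (massgQ A A' B B' E Ps Pt / massQ A A' B B' E Ps Pt)
      ↔ (1 - A' * Ps) * (1 - B' * Pt) < (1 - E) * (A' * Ps * (B' * Pt)) := by
  have hQ : 0 < massQ A A' B B' E Ps Pt := by
    rw [massQ_eq]
    have h1 : 0 ≤ (1 - A) * (1 - A' * Ps * B) := by
      apply mul_nonneg (by linarith)
      nlinarith [mul_le_mul_of_nonneg_right hA' hB.le]
    have h2 : 0 ≤ A * (1 - B) * (1 - B' * Pt) := by
      apply mul_nonneg (mul_nonneg hA.le (by linarith)) (by linarith)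
    nlinarith [mul_nonneg hE.le (add_nonneg h1 h2)]
  have hpos : 0 < A * (1 - A) * (B * (1 - B)) * E := by
    apply mul_pos (mul_pos (mul_pos hA (by linarith)) (mul_pos hB (by linarith))) hE
  have hcov : massfgQ A A' B B' E Ps Pt / massQ A A' B B' E Ps Pt
      - (massfQ A A' B B' E Ps Pt / massQ A A' B B' E Ps Pt)
          * (massgQ A A' B B' E Ps Pt / massQ A A' B B' E Ps Pt)
      = (massQ A A' B B' E Ps Pt * massfgQ A A' B B' E Ps Pt
          - massfQ A A' B B' E Ps Pt * massgQ A A' B B' E Ps Pt)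
          / (massQ A A' B B' E Ps Pt * massQ A A' B B' E Ps Pt) := by
    field_simp
  rw [← sub_neg, hcov, div_lt_iff₀ (mul_pos hQ hQ), zero_mul, covariance_numerator]
  constructor
  · intro h
    rcases mul_neg_iff.1 h with ⟨_, hb⟩ | ⟨ha, _⟩
    · linarith
    · linarith
  · intro h
    exact mul_neg_of_pos_of_neg hpos (by linarith)

/-- At every weight `7/8` the sign rule reads `(1−E)·A'Ps·B'Pt = 2401/32768 > 225/4096 = (1−A'Ps)(1−B'Pt)`,
so the conditional covariance is negative: the all-`7/8` witness of `BHKMixedCore.lean`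
(`−206143/36168196`), now as an instance of the general theorem. -/
theorem all_seven_eighths_negative :
    massfgQ (7/8) (7/8) (7/8) (7/8) (7/8) (7/8) (7/8) / massQ (7/8) (7/8) (7/8) (7/8) (7/8) (7/8) (7/8)
      < (massfQ (7/8) (7/8) (7/8) (7/8) (7/8) (7/8) (7/8) / massQ (7/8) (7/8) (7/8) (7/8) (7/8) (7/8) (7/8))
          * (massgQ (7/8) (7/8) (7/8) (7/8) (7/8) (7/8) (7/8)
              / massQ (7/8) (7/8) (7/8) (7/8) (7/8) (7/8) (7/8)) := by
  rw [covariance_neg_iff] <;> norm_num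

end Summit.Ventures.PercRepro2.BHKMixedK6General
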